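import Literature.RingTheory.DiscreteValuationRing.AdicCompletionResidueField
import Literature.NumberTheory.Automorphic.AdicCompletionLocalField
import Literature.NumberTheory.GaloisRepresentations.LocalField
import Literature.NumberTheory.GaloisRepresentations.IntegralGaloisAction
import HarnessLib

/-!
# `residueFieldCard K_v = q_v` in the `ValuativeRel` language of the local files

Topic `NumberTheory/Automorphic`; namespace `Literature.NumberTheory.Automorphic`. The residue field
of `𝒪_v ⊆ K_v` is `𝓞 K ⧸ v` and has `q_v = v.residueCard` elements: this is in the tree, in full
generality, as `IsDedekindDomain.HeightOneSpectrum.residueFieldEquiv` /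
`natCard_residueField_adicCompletion` of
`Literature.RingTheory.DiscreteValuationRing.AdicCompletionResidueField` (for `Valued`'s residue
field `𝓀[K_v]`), and for number fields also as
`NumberField.natCard_residueField_adicCompletionIntegers_eq_residueCard`
(`EllipticCurves/HasseWeilAbelianLSeriesProofs`) and `natCard_residueField_eq_residueCard`
(`EllipticCurves/HasseWeilGoodReductionFrobenius`). The local Whittaker files
(`ShintaniWhittakerFormula`, `WhittakerCoeffLocalDatum`, `WhittakerCoeffCuspidal`) are written in
the `ValuativeRel` / `IsNonarchimedeanLocalField` language of `AdicCompletionLocalField`, whose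
residue field `IsLocalRing.ResidueField 𝒪[K_v]` (`𝒪[K_v] = (valuation K_v).integer`) is a
*different type*. This file records the transport (~ the hypothesis `hq` of
`whittakerCoeff_smoothedForm_ofLocal_piPowGL_eq`, and the upgrade of
`residueFieldCard_adicCompletion_le` of `SatakeParameterGenericBound` to an equality):

* `residueFieldCard_adicCompletion_eq : residueFieldCard (v.adicCompletion K) = v.residueCard`;
* `natCard_valuativeResidueField_adicCompletion_eq : Nat.card 𝓀[K_v] = v.residueCard`
  (`ValuativeRel` notation).

Both are two-line consequences of the tree's statements: the two valuation rings of `K_v` are the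
same subring (equivalent valuations, `ValuativeRel.isEquiv`), so their residue fields are
isomorphic (`IsLocalRing.ResidueField.mapEquiv`).
-/

noncomputable section

namespace Literature.NumberTheory.Automorphic

open NumberField IsDedekindDomain

variable (K : Type*) [Field K] [NumberField K] (v : HeightOneSpectrum (𝓞 K))

open ValuativeRel GaloisRepresentations.IsNonarchimedeanLocalField in
/-- **`residueFieldCard K_v = q_v`** for the residue field of the `ValuativeRel` structure of the
local field `K_v` (`AdicCompletionLocalField`): its valuation ring is the same subring as Mathlib's
`Valued.integer K_v` (equivalent valuations), so the residue fields are isomorphic, and the latter has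
`#(𝓞 K ⧸ v) = q_v` elements (`IsDedekindDomain.HeightOneSpectrum.natCard_residueField_adicCompletion`
of `Literature.RingTheory.DiscreteValuationRing.AdicCompletionResidueField`,
`HeightOneSpectrum.residueCard_eq_card_quotient`). [folklore] -/
theorem residueFieldCard_adicCompletion_eq :
    residueFieldCard (v.adicCompletion K) = v.residueCard := by
  have hO : (valuation (v.adicCompletion K)).integer = Valued.integer (v.adicCompletion K) := by
    ext x
    rw [Valuation.mem_integer_iff]
    exact (ValuativeRel.isEquiv (valuation (v.adicCompletion K))
      (Valued.v : Valuation (v.adicCompletion K) _)).le_one_iff_le_one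
  have hcard : residueFieldCard (v.adicCompletion K) =
      Nat.card (IsLocalRing.ResidueField (Valued.integer (v.adicCompletion K))) :=
    Nat.card_congr (IsLocalRing.ResidueField.mapEquiv (RingEquiv.subringCongr hO)).toEquiv
  rw [hcard, HeightOneSpectrum.residueCard_eq_card_quotient]
  exact HeightOneSpectrum.natCard_residueField_adicCompletion K v

open ValuativeRel in
/-- The same equality in the notation of the local files: `Nat.card 𝓀[K_v] = q_v` for the residue
field `𝓀[K_v]` of the `ValuativeRel` valuation ring — the hypothesis `hq` of
`whittakerCoeff_smoothedForm_ofLocal_piPowGL_eq` (`WhittakerCoeffCuspidal`). [folklore] -/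
theorem natCard_valuativeResidueField_adicCompletion_eq :
    Nat.card 𝓀[v.adicCompletion K] = v.residueCard :=
  residueFieldCard_adicCompletion_eq K v

end Literature.NumberTheory.Automorphic
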